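import Summits.BirchSwinnertonDyer.BirchSwinnertonDyer.Theorems.PrintCFramAwayBinderCriterion
import Literature.NumberTheory.EllipticCurves.ArtinFormalismQuadraticLocalProofs
import HarnessLib

/-!
# Route PrintCFram, regime T (`LocalThreeTorsionBSDThree`, stmt-BirchSwinnertonDyer-20699): the GLOBAL
# DEFECT `d₀ = #W(K)[3^∞]` of the T package, class-wide — `W(K)[3] ≠ 0` on BOTH members of a frame iff
# the class is of cube-sum type, and `W(K)[3^∞] = 0` otherwise (cell `bsd-print-cfram`, seat p4 g3)

HONEST FRAMING (cell `bsd-print-cfram`, run/shared/lean/pub/bsd-print-cfram/, D-0131 (2) print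
tier; verbatim in every file of the seat): the cell works the partition leaf
`CornerF ∧ p ramified in the CM field K` (LADDER-BSD row K7r = B13; W-ALL row 12r) in PARTITION
currency — a leaf or a cell counts only when its theorem is in the kernel BY NAME. Nothing is
closed here. ty2's T package (planner ASK (δ), INBOX 18:30:52Z) displays the GLOBAL defect
`d₀ = #E(K)[3^∞]` of a `3`-frame (`K = ℚ(√−3)`); ty3's PART H table (kit j287122 ‖ j287127) found
`d₀ = 3` on the 178 T_cube classes and `d₀ = 1` on the 296 T_split (and on N, V). THIS FILE proves the
class-wide STRUCTURE behind those numbers, for every `j = 0` class at once and for any model: over any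
field `F ⊇ ℚ` generated by `θ` with `θ² = −3` (the frame field), a rational `k ≠ 0` is a square in `F`
iff `k ∈ ℚ²` or `−3k ∈ ℚ²` (`isSquare_ratCast_iff_of_sq_eq_neg_three`); hence (`§1` of p553346: with
`√−3 ∈ F`, `E_k(F)[3] ≠ 0 ⟺ k ∈ F²`) **`W(F)[3] ≠ 0 ⟺ (k ∈ ℚ² ∨ −3k ∈ ℚ²) ⟺ W′(F)[3] ≠ 0`** for the
pair `W ≅ E_k`, `W′ ≅ E_{−27k}` — the cube-sum type T_cube (p548859's rational-square test; ty3's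
`tSub = 1`) is exactly «`3 ∣ d₀` on both members», and on every other class (N, V, T_split)
`W(F)[3^∞] = 0`, i.e. `d₀ = 1` (`noThreePowerTorsion_of_noThreeTorsion`). For the number field of a
`3`-frame (`[K:ℚ] = 2`, `d_K = −3`) the generator `θ` and the `ℚ`-basis `{1, θ}` are derived
(`exists_sq_eq_discr_not_mem_range`), so the statements apply to ty2's `IsFrameThree` fields verbatim
(`threeTorsion_frameField_iff`). The exact value `d₀ ∈ {3, 9}` on T_cube (no `K`-point of order `9`;
`E[3] ⊄ E(K)`) stays a per-class certificate (ty3 PART H). Theorems only; no named fact.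
beyond-print: NO.

References: `Theorems/PrintCFramAwayBinderCriterion.lean` §1; `Theorems/PrintCFramTCubeSum.lean` (p548859);
ty3 `X12/CMRamifiedRecordSchemaH.lean`; [cite: SilvermanAEC2009, Exercise 3.7]; [cite: Marcus1977, Ch. 2 (quadratic fields)].
-/

set_option linter.dupNamespace false
set_option autoImplicit false

noncomputable section

open scoped Classical
open WeierstrassCurve Literature.NumberTheory.EllipticCurves
  Literature.NumberTheory.EllipticCurves.Rank1Residual
  Summit.BirchSwinnertonDyer.Rank1Residual Summit.BirchSwinnertonDyer.Rank1Residual.X12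

namespace Summit.BirchSwinnertonDyer.BirchSwinnertonDyer.Theorems.PrintCFram.GlobalDefect

/-! ## §1 Rational squares in `ℚ(θ)`, `θ² = −3` -/

section Squares

variable {F : Type*} [Field F] [CharZero F]

/-- `θ² = −3` forces `θ ∉ ℚ` (`−3` is not a rational square). [folklore] -/
theorem not_exists_ratCast_eq_of_sq_eq_neg_three {θ : F} (hθ : θ ^ 2 = -3) : ¬ ∃ q : ℚ, (q : F) = θ := by
  rintro ⟨q, hq⟩
  have h : ((q ^ 2 : ℚ) : F) = ((-3 : ℚ) : F) := by push_cast; rw [hq, hθ]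
  have hq2 : q ^ 2 = -3 := by exact_mod_cast h
  nlinarith [sq_nonneg q]

/-- **Rational squares in `ℚ(√−3)`.** If every element of `F` is `a + bθ` (`a, b ∈ ℚ`) with
`θ² = −3`, then a rational `k` is a square in `F` iff `k` or `−3k` is a rational square:
`(a + bθ)² = a² − 3b² + 2abθ ∈ ℚ` forces `ab = 0`. [cite: Marcus1977, Ch. 2 (quadratic fields)] -/
theorem isSquare_ratCast_iff_of_sq_eq_neg_three {θ : F} (hθ : θ ^ 2 = -3)
    (hF : ∀ z : F, ∃ a b : ℚ, z = a + b * θ) (k : ℚ) :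
    IsSquare (k : F) ↔ IsSquare k ∨ IsSquare (-3 * k) := by
  constructor
  · rintro ⟨z, hz⟩
    obtain ⟨a, b, rfl⟩ := hF z
    have hexp : (k : F) = ((a ^ 2 - 3 * b ^ 2 : ℚ) : F) + ((2 * a * b : ℚ) : F) * θ := by
      rw [hz]; push_cast; linear_combination (b ^ 2) * hθ
    by_cases hab : 2 * a * b = 0
    · have hk' : ((k : ℚ) : F) = ((a ^ 2 - 3 * b ^ 2 : ℚ) : F) := by
        rw [hexp, hab]; push_cast; ring
      have hk : k = a ^ 2 - 3 * b ^ 2 := Rat.cast_injective hk'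
      rcases mul_eq_zero.mp hab with ha | hb
      · rcases mul_eq_zero.mp ha with h2 | ha
        · norm_num at h2
        · right; exact ⟨3 * b, by rw [hk, ha]; ring⟩
      · left; exact ⟨a, by rw [hk, hb]; ring⟩
    · exfalso
      apply not_exists_ratCast_eq_of_sq_eq_neg_three hθ
      refine ⟨(k - (a ^ 2 - 3 * b ^ 2)) / (2 * a * b), ?_⟩
      have hne : ((2 * a * b : ℚ) : F) ≠ 0 := by exact_mod_cast hab
      push_cast at hexp hne ⊢
      rw [div_eq_iff hne]
      linear_combination hexp
  · rintro (⟨c, hc⟩ | ⟨c, hc⟩)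
    · exact ⟨(c : F), by rw [hc]; push_cast; ring⟩
    · refine ⟨(c : F) * θ / 3, ?_⟩
      have h3 : (3 : F) ≠ 0 := by norm_num
      field_simp
      have : ((-3 * k : ℚ) : F) = ((c * c : ℚ) : F) := by rw [hc]
      push_cast at this
      linear_combination (-3 : F) * this - (c : F) ^ 2 * hθ

end Squares

/-! ## §2 `3`-torsion of the pair `E_k`, `E_{−27k}` over `ℚ(√−3)` -/

section Pair

variable {F : Type*} [Field F] [CharZero F]

/-- **Over `F ∋ √−3`, cube-sum type gives `F`-rational `3`-torsion on BOTH members**: if `k ∈ ℚ²` or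
`−3k ∈ ℚ²` (`k ≠ 0`) then `E_k(F)` and `E_{−27k}(F)` each have a point of order `3` (`k`, `−27k ∈ F²`).
So `3 ∣ d₀(W)` and `3 ∣ d₀(W′)` on every T_cube frame. [cite: SilvermanAEC2009, Exercise 3.7] -/
theorem exists_three_torsion_pair_of_tCube {θ : F} (hθ : θ ^ 2 = -3) {k : ℚ} (hk : k ≠ 0)
    (h : IsSquare k ∨ IsSquare (-3 * k)) :
    (∃ P : (mordellCurve (k : F)).toAffine.Point, P ≠ 0 ∧ (3 : ℕ) • P = 0) ∧
      (∃ P : (mordellCurve ((-27 * k : ℚ) : F)).toAffine.Point, P ≠ 0 ∧ (3 : ℕ) • P = 0) := by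
  have hk' : (k : F) ≠ 0 := by exact_mod_cast hk
  have hk27 : ((-27 * k : ℚ) : F) ≠ 0 := by exact_mod_cast (mul_ne_zero (by norm_num) hk)
  -- both `k` and `−27k` are squares in `F`
  have hsqF : ∀ {q : ℚ}, (IsSquare q ∨ IsSquare (-3 * q)) → IsSquare (q : F) := by
    rintro q (⟨c, hc⟩ | ⟨c, hc⟩)
    · exact ⟨(c : F), by rw [hc]; push_cast; ring⟩
    · refine ⟨(c : F) * θ / 3, ?_⟩
      have h3 : (3 : F) ≠ 0 := by norm_num
      field_simp
      have : ((-3 * q : ℚ) : F) = ((c * c : ℚ) : F) := by rw [hc]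
      push_cast at this
      linear_combination (-3 : F) * this - (c : F) ^ 2 * hθ
  have h27 : IsSquare (-27 * k) ∨ IsSquare (-3 * (-27 * k)) := by
    rcases h with ⟨c, hc⟩ | ⟨c, hc⟩
    · right; exact ⟨9 * c, by rw [hc]; ring⟩
    · left; exact ⟨3 * c, by linear_combination 9 * hc⟩
  exact ⟨exists_three_torsion_mordellCurve_of_isSquare hk' (hsqF h),
    exists_three_torsion_mordellCurve_of_isSquare hk27 (hsqF h27)⟩

/-- **Over `F = ℚ(√−3)`, NOT cube-sum type gives NO `F`-rational `3`-torsion on EITHER member**: if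
neither `k` nor `−3k` is a rational square then `E_k(F)[3] = 0` and `E_{−27k}(F)[3] = 0` — `d₀ = 1` on
the regimes N, V and T_split. [cite: SilvermanAEC2009, Exercise 3.7] [cite: Marcus1977, Ch. 2 (quadratic fields)] -/
theorem noThreeTorsion_pair_of_not_tCube {θ : F} (hθ : θ ^ 2 = -3)
    (hF : ∀ z : F, ∃ a b : ℚ, z = a + b * θ) {k : ℚ} (hk : k ≠ 0)
    (h : ¬ (IsSquare k ∨ IsSquare (-3 * k))) :
    (∀ P : (mordellCurve (k : F)).toAffine.Point, (3 : ℕ) • P = 0 → P = 0) ∧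
      (∀ P : (mordellCurve ((-27 * k : ℚ) : F)).toAffine.Point, (3 : ℕ) • P = 0 → P = 0) := by
  have hk' : (k : F) ≠ 0 := by exact_mod_cast hk
  have hk27 : ((-27 * k : ℚ) : F) ≠ 0 := by exact_mod_cast (mul_ne_zero (by norm_num) hk)
  refine ⟨(noThreeTorsion_mordellCurve_iff_of_sq_eq_neg_three hk' hθ).mpr ?_,
    (noThreeTorsion_mordellCurve_iff_of_sq_eq_neg_three hk27 hθ).mpr ?_⟩
  · rwa [isSquare_ratCast_iff_of_sq_eq_neg_three hθ hF]
  · rw [isSquare_ratCast_iff_of_sq_eq_neg_three hθ hF]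
    rintro (⟨c, hc⟩ | ⟨c, hc⟩)
    · exact h (Or.inr ⟨c / 3, by linear_combination hc / 9⟩)
    · exact h (Or.inl ⟨c / 9, by linear_combination hc / 81⟩)

/-- **The T_cube bit over `ℚ(√−3)`, as an iff on either member:** `E_k(F)[3] ≠ 0 ⟺ k ∈ ℚ² ∨ −3k ∈ ℚ²
⟺ E_{−27k}(F)[3] ≠ 0`. [cite: SilvermanAEC2009, Exercise 3.7] -/
theorem exists_three_torsion_iff_tCube {θ : F} (hθ : θ ^ 2 = -3)
    (hF : ∀ z : F, ∃ a b : ℚ, z = a + b * θ) {k : ℚ} (hk : k ≠ 0) :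
    ((∃ P : (mordellCurve (k : F)).toAffine.Point, P ≠ 0 ∧ (3 : ℕ) • P = 0) ↔
        (IsSquare k ∨ IsSquare (-3 * k))) ∧
      ((∃ P : (mordellCurve ((-27 * k : ℚ) : F)).toAffine.Point, P ≠ 0 ∧ (3 : ℕ) • P = 0) ↔
        (IsSquare k ∨ IsSquare (-3 * k))) := by
  constructor
  · refine ⟨fun hP => ?_, fun h => (exists_three_torsion_pair_of_tCube hθ hk h).1⟩
    by_contra h
    obtain ⟨P, hP0, hP3⟩ := hP
    exact hP0 ((noThreeTorsion_pair_of_not_tCube hθ hF hk h).1 P hP3)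
  · refine ⟨fun hP => ?_, fun h => (exists_three_torsion_pair_of_tCube hθ hk h).2⟩
    by_contra h
    obtain ⟨P, hP0, hP3⟩ := hP
    exact hP0 ((noThreeTorsion_pair_of_not_tCube hθ hF hk h).2 P hP3)

/-- `A[3] = 0 ⟹ A[3^∞] = 0` (induction on the exponent): `d₀ = 1` as soon as there is no point of
order `3`. [folklore] -/
theorem noThreePowerTorsion_of_noThreeTorsion {A : Type*} [AddCommGroup A]
    (h : ∀ P : A, (3 : ℕ) • P = 0 → P = 0) : ∀ (n : ℕ) (P : A), (3 : ℕ) ^ n • P = 0 → P = 0 := by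
  intro n
  induction n with
  | zero => intro P hP; simpa using hP
  | succ n ih =>
    intro P hP
    refine ih P (h _ ?_)
    rw [← mul_nsmul, ← pow_succ]
    exact hP

end Pair

/-! ## §3 The frame field: `[K:ℚ] = 2`, `d_K = −3` -/

section Frame

variable {K : Type} [Field K] [NumberField K]

/-- **The frame field is `ℚ(θ)`, `θ² = −3`, with `ℚ`-basis `{1, θ}`** (`[K:ℚ] = 2`, `d_K = −3`;
tree `exists_sq_eq_discr_not_mem_range`). [cite: Marcus1977, Ch. 2 (quadratic fields)] -/
theorem exists_generator_frameField (hK2 : Module.finrank ℚ K = 2) (hdK : NumberField.discr K = -3) :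
    ∃ θ : K, θ ^ 2 = -3 ∧ ∀ z : K, ∃ a b : ℚ, z = a + b * θ := by
  obtain ⟨θ, hθQ, hθsq⟩ := exists_sq_eq_discr_not_mem_range K hK2
  have hθ : θ ^ 2 = -3 := by
    rw [hθsq, hdK]; simp
  refine ⟨θ, hθ, fun z => ?_⟩
  -- `{1, θ}` is linearly independent over `ℚ`, hence a basis (finrank 2)
  have hli : LinearIndependent ℚ ![(1 : K), θ] := by
    refine LinearIndependent.pair_iff.mpr fun s t hst => ?_
    by_cases ht : t = 0
    · simp [ht] at hst
      exact ⟨hst, ht⟩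
    · exfalso
      apply hθQ
      refine ⟨-s / t, ?_⟩
      have hst' : (s : K) + (t : K) * θ = 0 := by
        simpa [Algebra.smul_def] using hst
      have htK : (t : K) ≠ 0 := by exact_mod_cast ht
      rw [eq_ratCast]
      push_cast
      rw [div_eq_iff htK]
      linear_combination -hst'
  have hspan : Submodule.span ℚ (Set.range ![(1 : K), θ]) = ⊤ :=
    hli.span_eq_top_of_card_eq_finrank' (by simp [hK2])
  have hz : z ∈ Submodule.span ℚ (Set.range ![(1 : K), θ]) := by rw [hspan]; exact Submodule.mem_top
  rw [Matrix.range_cons, Matrix.range_cons, Matrix.range_empty, Set.union_empty,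
    Set.union_singleton, Submodule.mem_span_pair] at hz
  obtain ⟨a, b, hab⟩ := hz
  exact ⟨b, a, by rw [← hab]; simp only [Algebra.smul_def, eq_ratCast, mul_one]; ring⟩

/-- **`d₀` on a `3`-frame, class-wide.** Let `[K:ℚ] = 2`, `d_K = −3` and `W` ANY model over `ℚ` of
`y² = x³ + k` (`C • W = E_k`, `k ≠ 0`). Then `W(K)` has a point of order `3` iff `k ∈ ℚ²` or `−3k ∈ ℚ²`
(cube-sum type, ty3's `tSub = 1`); otherwise `W(K)[3^∞] = 0` (`d₀ = 1`). The same holds for the twin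
`W′ ≅ E_{−27k}` with the SAME condition. [cite: SilvermanAEC2009, Exercise 3.7] [cite: Marcus1977, Ch. 2 (quadratic fields)] -/
theorem threeTorsion_frameField_iff (hK2 : Module.finrank ℚ K = 2) (hdK : NumberField.discr K = -3)
    {W : WeierstrassCurve ℚ} {C : VariableChange ℚ} {k : ℚ} (hk : k ≠ 0)
    (hW : C • W = mordellCurve k) :
    ((∀ Q : (W.baseChange K).toAffine.Point, (3 : ℕ) • Q = 0 → Q = 0) ↔
        ¬ (IsSquare k ∨ IsSquare (-3 * k))) ∧
      ((¬ (IsSquare k ∨ IsSquare (-3 * k))) →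
        ∀ (n : ℕ) (Q : (W.baseChange K).toAffine.Point), (3 : ℕ) ^ n • Q = 0 → Q = 0) := by
  obtain ⟨θ, hθ, hF⟩ := exists_generator_frameField hK2 hdK
  have h1 := JZeroThree.noThreeTorsion_baseChange_iff_of_smul_eq hW K
  rw [mordellCurve_baseChange] at h1
  have hcast : algebraMap ℚ K k = (k : K) := rfl
  rw [hcast] at h1
  have key : (∀ Q : (W.baseChange K).toAffine.Point, (3 : ℕ) • Q = 0 → Q = 0) ↔
      ¬ (IsSquare k ∨ IsSquare (-3 * k)) := by
    rw [h1, JZeroThree.forall_three_nsmul_iff_not_exists, (exists_three_torsion_iff_tCube hθ hF hk).1]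
  exact ⟨key, fun h => noThreePowerTorsion_of_noThreeTorsion (key.mpr h)⟩

end Frame

end Summit.BirchSwinnertonDyer.BirchSwinnertonDyer.Theorems.PrintCFram.GlobalDefect

end
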